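import Summits.ResolutionOfSingularities.ResolutionOfSingularities.Theorems.WildQuotientsWildQuotientResolutionThird112Defs
import Summits.ResolutionOfSingularities.ResolutionOfSingularities.Theorems.WildQuotientsWildQuotientResolutionToricExitWeightZero

/-!
# V4U piece 0, B0-a: the `⅓(1,1,2)` presentation has range exactly the `ℤ/3`-weight-`0` part

(crux stmt-ResolutionOfSingularities-15640 `WildQuotients.WildQuotientResolution`, line `Sketch`,
sector `|G| = p`; programme V4U of `L/w45c/CHAIN.md` v6 / `V4U-DESIGN.md` §2, res-L1-w45c-plan-1
RULING v6.3 (4) «B0 SPLIT» and ORDER B0-a (STATUS 2026-08-27T05:16:33Z; SIG elaborated by plan-1,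
`B0aSig.lean`); consumers: res-L1-w45c-stub-1's B0-b transport `chart0_fixedPoints_eq` and
res-L1-w45c-stub-4's `Third112.blowup_regular` (p498815). [OURS · L1 W4.5c] — NOT a statement of
any manuscript (Hironaka 2017 is consumed nowhere); replaces the role of no printed item. AI-written
Lean, kernel-checked; weaker than expert review.)

The `μ₃`-vertex of the weighted blow-up `Bl_{I₆} 𝔸ⁿ` (V4U piece 0) has, after the translation
lemmas, the invariant ring `(k[u₁,u₂,u₃,pass])^{μ₃}` for the weights `(1,1,2,0,…,0) (mod 3)`; the
chain presents it by `Third112.presentation k n a b c : k[Fin n ⊕ Fin 4] → k[Fin n]`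
(`inl a,b,c ↦ X a³, X b³, X c³`, `inl i ↦ X i` passengers, `inr 0..3 ↦ X a²X b, X aX b², X aX c,
X bX c`). This file proves that its range IS the weight-`0` part:

* `coneWeight n a b c : Fin n → ZMod 3` — the weight `a ↦ 1, b ↦ 1, c ↦ 2`, passengers `↦ 0`;
* `monomial_mem_of_coneWeight_dvd` — SEMIGROUP GENERATION in «any subalgebra» form: a monomial with
  `3 ∣ d a + d b + 2 d c` lies in every subalgebra containing the seven cone monomials and the
  passengers (peel `X c³`, absorb the residual `X c`'s by `X aX c` / `X bX c`, then `X a³`, `X b³`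
  and the residues `(1,2,0) = X aX b²`, `(2,1,0) = X a²X b`);
* `weight_coneWeight` — `Finsupp.weight (coneWeight n a b c) d = ↑(d a + d b + 2 d c)` in `ZMod 3`;
* `monomial_mem_range_presentation` — hence every weight-`0` monomial is in the range;
* `mem_range_presentation_iff` — **`f ∈ (presentation k n a b c).range ↔
  IsWeightedHomogeneous (coneWeight n a b c) f 0`** (via res-L1-w45c-stub-1's
  `ToricExit.mem_adjoin_iff_isWeightedHomogeneous_zero`, p490929).

Hypotheses: `a, b, c` pairwise distinct; `k` a field (as in `Third112Defs`; the subalgebra lemma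
is stated over any commutative ring). Nothing in `Third112Defs` / `ToricExitWeightZero` is
redefined or restated.
-/

-- single-problem summit: the doubled namespace component `ResolutionOfSingularities` is forced
set_option linter.dupNamespace false

noncomputable section

open MvPolynomial

namespace Summit.ResolutionOfSingularities.ResolutionOfSingularities.Theorems.WildQuotientResolution.Third112

/-- The `μ₃`-weight of V4U piece 0 on `k[x₁,…,xₙ]`: `a ↦ 1`, `b ↦ 1`, `c ↦ 2`, every passenger
`↦ 0`, valued in `ZMod 3` (V4U-DESIGN §2: `(u₁,u₂,u₃) = (ρ, N, c′)` of weights `(1,1,2)`; for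
`p ≡ 2 (mod 3)` the permuted triple has weights `(1,2,2) ≡ 2·(2,1,1)`, the same semigroup, so one
statement serves both residues). [OURS · L1 W4.5c; plan-1 ORDER B0-a SIG verbatim] -/
def coneWeight (n : ℕ) (a b c : Fin n) : Fin n → ZMod 3 :=
  fun i => if i = a then 1 else if i = b then 1 else if i = c then 2 else 0

section AnySubalgebra

variable {R : Type*} [CommRing R] {n : ℕ}

/-- Residues on the `(a,b)`-face: `3 ∣ ea + eb ⇒ X a ^ ea * X b ^ eb ∈ A` for any subalgebra `A`
containing `X a³, X b³, X a²X b, X aX b²` (write `ea = 3s + i`, `eb = 3t + j`; the residue pairs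
with `3 ∣ i + j` are `(0,0), (1,2), (2,1)`). [OURS · W4.5c] -/
theorem X_pow_mul_X_pow_mem {A : Subalgebra R (MvPolynomial (Fin n) R)} {a b : Fin n}
    (h1 : X a ^ 3 ∈ A) (h2 : X b ^ 3 ∈ A) (h4 : X a ^ 2 * X b ∈ A) (h5 : X a * X b ^ 2 ∈ A)
    (ea eb : ℕ) (h : (ea + eb) % 3 = 0) :
    X a ^ ea * X b ^ eb ∈ A := by
  have hea : ea = 3 * (ea / 3) + ea % 3 := (Nat.div_add_mod ea 3).symm
  have heb : eb = 3 * (eb / 3) + eb % 3 := (Nat.div_add_mod eb 3).symm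
  have hi : ea % 3 < 3 := Nat.mod_lt _ (by norm_num)
  have hj : eb % 3 < 3 := Nat.mod_lt _ (by norm_num)
  have hij : (ea % 3 + eb % 3) % 3 = 0 := by rw [← Nat.add_mod]; exact h
  have e : (X a ^ ea * X b ^ eb : MvPolynomial (Fin n) R)
      = ((X a ^ 3) ^ (ea / 3) * (X b ^ 3) ^ (eb / 3)) * (X a ^ (ea % 3) * X b ^ (eb % 3)) := by
    conv_lhs => rw [hea, heb]
    rw [pow_add, pow_add, pow_mul, pow_mul]; ring
  rw [e]
  refine A.mul_mem (A.mul_mem (A.pow_mem h1 _) (A.pow_mem h2 _)) ?_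
  generalize ea % 3 = i at hi hij ⊢
  generalize eb % 3 = j at hj hij ⊢
  have key : (i = 0 ∧ j = 0) ∨ (i = 1 ∧ j = 2) ∨ (i = 2 ∧ j = 1) := by omega
  rcases key with ⟨rfl, rfl⟩ | ⟨rfl, rfl⟩ | ⟨rfl, rfl⟩
  · simp
  · simpa [pow_one] using h5
  · simpa [pow_one] using h4

/-- **Semigroup generation, `(a,b,c)`-part**: `3 ∣ ea + eb + 2 ec ⇒ X a ^ ea * X b ^ eb * X c ^ ec
∈ A` for any subalgebra `A` containing the seven `⅓(1,1,2)` cone monomials. Route: peel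
`(X c³)^(ec / 3)`; a residual `X c` (resp. `X c²`) is absorbed by one (resp. two) of `X aX c`,
`X bX c` — available because `ea + eb ≡ 1` (resp. `≡ 2`) forces enough `a/b`-exponent; the rest is
the `(a,b)`-face. (Plan-1's nine residual cases `(0,0,0), (1,2,0), (2,1,0), (1,0,1), (0,1,1),
(2,0,2), (0,2,2), (1,1,2), (2,2,1)` are exactly the leaves of this recursion.) [OURS · W4.5c] -/
theorem X_pow_mul_X_pow_mul_X_pow_mem {A : Subalgebra R (MvPolynomial (Fin n) R)} {a b c : Fin n}
    (h1 : X a ^ 3 ∈ A) (h2 : X b ^ 3 ∈ A) (h3 : X c ^ 3 ∈ A) (h4 : X a ^ 2 * X b ∈ A)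
    (h5 : X a * X b ^ 2 ∈ A) (h6 : X a * X c ∈ A) (h7 : X b * X c ∈ A)
    (ea eb ec : ℕ) (h : (ea + eb + 2 * ec) % 3 = 0) :
    X a ^ ea * X b ^ eb * X c ^ ec ∈ A := by
  have hec : ec = 3 * (ec / 3) + ec % 3 := (Nat.div_add_mod ec 3).symm
  have hr : ec % 3 < 3 := Nat.mod_lt _ (by norm_num)
  have e : (X a ^ ea * X b ^ eb * X c ^ ec : MvPolynomial (Fin n) R)
      = (X c ^ 3) ^ (ec / 3) * (X a ^ ea * X b ^ eb * X c ^ (ec % 3)) := by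
    conv_lhs => rw [hec]
    rw [pow_add, pow_mul]; ring
  rw [e]
  refine A.mul_mem (A.pow_mem h3 _) ?_
  have h' : (ea + eb + 2 * (ec % 3)) % 3 = 0 := by
    have : (ea + eb + 2 * ec) % 3 = (ea + eb + 2 * (ec % 3)) % 3 := by
      conv_lhs => rw [hec]
      omega
    rw [← this]; exact h
  interval_cases hrc : ec % 3
  · -- residual `X c`-exponent 0: the `(a,b)`-face
    rw [pow_zero, mul_one]
    exact X_pow_mul_X_pow_mem h1 h2 h4 h5 ea eb (by simpa using h')
  · -- residual `X c`: absorb it with `X a X c` or `X b X c`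
    rcases Nat.eq_zero_or_pos ea with hea | hea
    · rcases Nat.eq_zero_or_pos eb with heb | heb
      · exfalso; subst hea; subst heb; omega
      · obtain ⟨eb', rfl⟩ : ∃ eb', eb = eb' + 1 := ⟨eb - 1, by omega⟩
        subst hea
        have e2 : (X a ^ 0 * X b ^ (eb' + 1) * X c ^ 1 : MvPolynomial (Fin n) R)
            = (X a ^ 0 * X b ^ eb') * (X b * X c) := by ring
        rw [e2]
        exact A.mul_mem (X_pow_mul_X_pow_mem h1 h2 h4 h5 0 eb' (by omega)) h7
    · obtain ⟨ea', rfl⟩ : ∃ ea', ea = ea' + 1 := ⟨ea - 1, by omega⟩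
      have e2 : (X a ^ (ea' + 1) * X b ^ eb * X c ^ 1 : MvPolynomial (Fin n) R)
          = (X a ^ ea' * X b ^ eb) * (X a * X c) := by ring
      rw [e2]
      exact A.mul_mem (X_pow_mul_X_pow_mem h1 h2 h4 h5 ea' eb (by omega)) h6
  · -- residual `X c²`: absorb it with two of `X a X c`, `X b X c`
    rcases Nat.lt_or_ge ea 2 with hea | hea
    · interval_cases ea
      · obtain ⟨eb', rfl⟩ : ∃ eb', eb = eb' + 2 := ⟨eb - 2, by omega⟩
        have e2 : (X a ^ 0 * X b ^ (eb' + 2) * X c ^ 2 : MvPolynomial (Fin n) R)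
            = (X a ^ 0 * X b ^ eb') * ((X b * X c) * (X b * X c)) := by ring
        rw [e2]
        exact A.mul_mem (X_pow_mul_X_pow_mem h1 h2 h4 h5 0 eb' (by omega)) (A.mul_mem h7 h7)
      · obtain ⟨eb', rfl⟩ : ∃ eb', eb = eb' + 1 := ⟨eb - 1, by omega⟩
        have e2 : (X a ^ 1 * X b ^ (eb' + 1) * X c ^ 2 : MvPolynomial (Fin n) R)
            = (X a ^ 0 * X b ^ eb') * ((X a * X c) * (X b * X c)) := by ring
        rw [e2]
        exact A.mul_mem (X_pow_mul_X_pow_mem h1 h2 h4 h5 0 eb' (by omega)) (A.mul_mem h6 h7)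
    · obtain ⟨ea', rfl⟩ : ∃ ea', ea = ea' + 2 := ⟨ea - 2, by omega⟩
      have e2 : (X a ^ (ea' + 2) * X b ^ eb * X c ^ 2 : MvPolynomial (Fin n) R)
          = (X a ^ ea' * X b ^ eb) * ((X a * X c) * (X a * X c)) := by ring
      rw [e2]
      exact A.mul_mem (X_pow_mul_X_pow_mem h1 h2 h4 h5 ea' eb (by omega)) (A.mul_mem h6 h6)

/-- Exponent bookkeeping: `d = single a (d a) + single b (d b) + single c (d c) + d|_{passengers}`
for pairwise distinct `a, b, c`. [folklore] -/
theorem eq_single_add_single_add_single_add_filter {a b c : Fin n} (hab : a ≠ b) (hbc : b ≠ c)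
    (hac : a ≠ c) (d : Fin n →₀ ℕ) :
    d = Finsupp.single a (d a) + Finsupp.single b (d b) + Finsupp.single c (d c)
      + d.filter (fun i => i ≠ a ∧ i ≠ b ∧ i ≠ c) := by
  classical
  ext i
  simp only [Finsupp.coe_add, Pi.add_apply, Finsupp.single_apply, Finsupp.filter_apply]
  have hba : b ≠ a := hab.symm
  have hcb : c ≠ b := hbc.symm
  have hca : c ≠ a := hac.symm
  by_cases hia : i = a
  · rw [hia]; simp [hba, hca]
  · by_cases hib : i = b
    · rw [hib]; simp [hab, hcb]
    · by_cases hic : i = c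
      · rw [hic]; simp [hac, hbc]
      · simp [hia, hib, hic, Ne.symm hia, Ne.symm hib, Ne.symm hic]

/-- Monomial splitting along the bookkeeping identity:
`x^d = X a ^ d a * X b ^ d b * X c ^ d c * x^{d|passengers}`. [folklore] -/
theorem monomial_eq_abc_mul_passengers {a b c : Fin n} (hab : a ≠ b) (hbc : b ≠ c) (hac : a ≠ c)
    (d : Fin n →₀ ℕ) :
    (monomial d (1 : R) : MvPolynomial (Fin n) R)
      = X a ^ d a * X b ^ d b * X c ^ d c *
        monomial (d.filter fun i => i ≠ a ∧ i ≠ b ∧ i ≠ c) 1 := by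
  have hd := eq_single_add_single_add_single_add_filter hab hbc hac d
  conv_rhs => rw [X_pow_eq_monomial, X_pow_eq_monomial, X_pow_eq_monomial, monomial_mul,
    monomial_mul, monomial_mul, mul_one, mul_one, mul_one]
  rw [← hd]

/-- Passenger monomials lie in any subalgebra containing the passenger variables. [folklore] -/
theorem monomial_passengers_mem {A : Subalgebra R (MvPolynomial (Fin n) R)} {a b c : Fin n}
    (hpass : ∀ i, i ≠ a → i ≠ b → i ≠ c → X i ∈ A) (d : Fin n →₀ ℕ) :
    (monomial (d.filter fun i => i ≠ a ∧ i ≠ b ∧ i ≠ c) (1 : R) : MvPolynomial (Fin n) R)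
      ∈ A := by
  classical
  rw [monomial_eq, C_1, one_mul, Finsupp.prod]
  refine A.prod_mem fun i hi => A.pow_mem ?_ _
  rw [Finsupp.mem_support_iff, Finsupp.filter_apply] at hi
  split_ifs at hi with h
  · exact hpass i h.1 h.2.1 h.2.2
  · exact absurd rfl hi

/-- **B0-a in «any subalgebra» form**: a monomial `x^d` with `3 ∣ d a + d b + 2 d c` lies in every
subalgebra of `R[x₁,…,xₙ]` containing the seven `⅓(1,1,2)` generators
`X a³, X b³, X c³, X a²X b, X aX b², X aX c, X bX c` and the passengers `X i` (`i ∉ {a,b,c}`).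
[OURS · W4.5c] -/
theorem monomial_mem_of_coneWeight_dvd {A : Subalgebra R (MvPolynomial (Fin n) R)} {a b c : Fin n}
    (hab : a ≠ b) (hbc : b ≠ c) (hac : a ≠ c)
    (h1 : X a ^ 3 ∈ A) (h2 : X b ^ 3 ∈ A) (h3 : X c ^ 3 ∈ A) (h4 : X a ^ 2 * X b ∈ A)
    (h5 : X a * X b ^ 2 ∈ A) (h6 : X a * X c ∈ A) (h7 : X b * X c ∈ A)
    (hpass : ∀ i, i ≠ a → i ≠ b → i ≠ c → X i ∈ A)
    (d : Fin n →₀ ℕ) (hd : (d a + d b + 2 * d c) % 3 = 0) :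
    (monomial d (1 : R) : MvPolynomial (Fin n) R) ∈ A := by
  rw [monomial_eq_abc_mul_passengers hab hbc hac d]
  exact A.mul_mem (X_pow_mul_X_pow_mul_X_pow_mem h1 h2 h3 h4 h5 h6 h7 _ _ _ hd)
    (monomial_passengers_mem hpass d)

end AnySubalgebra

section Weight

variable {n : ℕ}

/-- `coneWeight` on the three cone variables and on passengers. [folklore] -/
theorem coneWeight_a (a b c : Fin n) : coneWeight n a b c a = 1 := by simp [coneWeight]

/-- see `coneWeight_a`. -/
theorem coneWeight_b (a b c : Fin n) (hab : a ≠ b) : coneWeight n a b c b = 1 := by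
  simp [coneWeight, hab.symm]

/-- see `coneWeight_a`. -/
theorem coneWeight_c (a b c : Fin n) (hac : a ≠ c) (hbc : b ≠ c) : coneWeight n a b c c = 2 := by
  simp [coneWeight, hac.symm, hbc.symm]

/-- see `coneWeight_a`. -/
theorem coneWeight_of_ne (a b c i : Fin n) (hia : i ≠ a) (hib : i ≠ b) (hic : i ≠ c) :
    coneWeight n a b c i = 0 := by
  simp [coneWeight, hia, hib, hic]

/-- **The `μ₃`-weight of an exponent vector** is `d a + d b + 2 d c (mod 3)`. [OURS · W4.5c] -/
theorem weight_coneWeight {a b c : Fin n} (hab : a ≠ b) (hbc : b ≠ c) (hac : a ≠ c)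
    (d : Fin n →₀ ℕ) :
    Finsupp.weight (coneWeight n a b c) d = ((d a + d b + 2 * d c : ℕ) : ZMod 3) := by
  classical
  have hpass : Finsupp.weight (coneWeight n a b c) (d.filter fun i => i ≠ a ∧ i ≠ b ∧ i ≠ c)
      = 0 := by
    rw [Finsupp.weight_apply, Finsupp.sum]
    refine Finset.sum_eq_zero fun i hi => ?_
    rw [Finsupp.mem_support_iff, Finsupp.filter_apply] at hi
    split_ifs at hi with h
    · rw [coneWeight_of_ne a b c i h.1 h.2.1 h.2.2, smul_zero]
    · exact absurd rfl hi
  conv_lhs => rw [eq_single_add_single_add_single_add_filter hab hbc hac d]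
  rw [map_add, map_add, map_add, hpass, add_zero, Finsupp.weight_single, Finsupp.weight_single,
    Finsupp.weight_single, coneWeight_a, coneWeight_b a b c hab, coneWeight_c a b c hac hbc]
  simp only [nsmul_eq_mul, Nat.cast_add, Nat.cast_mul, Nat.cast_ofNat, mul_one]
  ring

/-- `Finsupp.weight (coneWeight n a b c) d = 0 ↔ 3 ∣ d a + d b + 2 d c`. [OURS · W4.5c] -/
theorem weight_coneWeight_eq_zero_iff {a b c : Fin n} (hab : a ≠ b) (hbc : b ≠ c) (hac : a ≠ c)
    (d : Fin n →₀ ℕ) :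
    Finsupp.weight (coneWeight n a b c) d = 0 ↔ (d a + d b + 2 * d c) % 3 = 0 := by
  rw [weight_coneWeight hab hbc hac, ZMod.natCast_eq_zero_iff, Nat.dvd_iff_mod_eq_zero]

end Weight

section Range

variable (k : Type) [Field k] (n : ℕ) (a b c : Fin n)

/-- The range of the presentation is the subalgebra generated by the `n + 4` images.
[folklore; `Algebra.adjoin_range_eq_range_aeval`] -/
theorem range_presentation_eq_adjoin :
    (presentation k n a b c).range = Algebra.adjoin k (Set.range (Sum.elim
      (fun i => if i = a then X a ^ 3 else if i = b then X b ^ 3 else if i = c then X c ^ 3 else X i)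
      (![X a ^ 2 * X b, X a * X b ^ 2, X a * X c, X b * X c] :
        Fin 4 → MvPolynomial (Fin n) k))) := by
  rw [presentation, ← Algebra.adjoin_range_eq_range_aeval]

variable {k n a b c}

/-- Every image of the presentation is `μ₃`-weight-`0` homogeneous (degrees `3•1`, `3•1`,
`3•2`, `w i = 0`, `2•1+1`, `1+2•1`, `1+2`, `1+2`, all `= 0` in `ZMod 3`). [OURS · W4.5c] -/
theorem isWeightedHomogeneous_zero_of_mem_range_gens (hab : a ≠ b) (hbc : b ≠ c) (hac : a ≠ c)
    (g : MvPolynomial (Fin n) k)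
    (hg : g ∈ Set.range (Sum.elim
      (fun i => if i = a then X a ^ 3 else if i = b then X b ^ 3 else if i = c then X c ^ 3 else X i)
      (![X a ^ 2 * X b, X a * X b ^ 2, X a * X c, X b * X c] :
        Fin 4 → MvPolynomial (Fin n) k))) :
    IsWeightedHomogeneous (coneWeight n a b c) g 0 := by
  have hXa : IsWeightedHomogeneous (coneWeight n a b c) (X a : MvPolynomial (Fin n) k) 1 := by
    simpa [coneWeight_a] using isWeightedHomogeneous_X k (coneWeight n a b c) a
  have hXb : IsWeightedHomogeneous (coneWeight n a b c) (X b : MvPolynomial (Fin n) k) 1 := by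
    simpa [coneWeight_b a b c hab] using isWeightedHomogeneous_X k (coneWeight n a b c) b
  have hXc : IsWeightedHomogeneous (coneWeight n a b c) (X c : MvPolynomial (Fin n) k) 2 := by
    simpa [coneWeight_c a b c hac hbc] using isWeightedHomogeneous_X k (coneWeight n a b c) c
  have h3 : (3 • (1 : ZMod 3)) = 0 := by decide
  have h3' : (3 • (2 : ZMod 3)) = 0 := by decide
  have h21 : (2 • (1 : ZMod 3) + 1) = 0 := by decide
  have h12 : ((1 : ZMod 3) + 2 • 1) = 0 := by decide
  have h12' : ((1 : ZMod 3) + 2) = 0 := by decide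
  obtain ⟨s, rfl⟩ := hg
  rcases s with i | l
  · simp only [Sum.elim_inl]
    by_cases hia : i = a
    · rw [if_pos hia, ← h3]; exact hXa.pow 3
    · rw [if_neg hia]
      by_cases hib : i = b
      · rw [if_pos hib, ← h3]; exact hXb.pow 3
      · rw [if_neg hib]
        by_cases hic : i = c
        · rw [if_pos hic, ← h3']; exact hXc.pow 3
        · rw [if_neg hic]
          simpa [coneWeight_of_ne a b c i hia hib hic] using
            isWeightedHomogeneous_X k (coneWeight n a b c) i
  · simp only [Sum.elim_inr]
    fin_cases l
    · show IsWeightedHomogeneous (coneWeight n a b c) (X a ^ 2 * X b) 0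
      rw [← h21]; exact (hXa.pow 2).mul hXb
    · show IsWeightedHomogeneous (coneWeight n a b c) (X a * X b ^ 2) 0
      rw [← h12]; exact hXa.mul (hXb.pow 2)
    · show IsWeightedHomogeneous (coneWeight n a b c) (X a * X c) 0
      rw [← h12']; exact hXa.mul hXc
    · show IsWeightedHomogeneous (coneWeight n a b c) (X b * X c) 0
      rw [← h12']; exact hXb.mul hXc

/-- **B0-a, monomial form** (plan-1 ORDER SIG verbatim): every `μ₃`-weight-`0` monomial lies in the
range of the `⅓(1,1,2)` presentation. [OURS · W4.5c] -/
theorem monomial_mem_range_presentation (k : Type) [Field k] (n : ℕ) (a b c : Fin n)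
    (hab : a ≠ b) (hbc : b ≠ c) (hac : a ≠ c) (d : Fin n →₀ ℕ)
    (hd : Finsupp.weight (coneWeight n a b c) d = 0) :
    (monomial d (1 : k)) ∈ (presentation k n a b c).range := by
  rw [range_presentation_eq_adjoin]
  set G := Set.range (Sum.elim
      (fun i => if i = a then X a ^ 3 else if i = b then X b ^ 3 else if i = c then X c ^ 3 else X i)
      (![X a ^ 2 * X b, X a * X b ^ 2, X a * X c, X b * X c] :
        Fin 4 → MvPolynomial (Fin n) k)) with hG
  have mem : ∀ s, Sum.elim
      (fun i => if i = a then X a ^ 3 else if i = b then X b ^ 3 else if i = c then X c ^ 3 else X i)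
      (![X a ^ 2 * X b, X a * X b ^ 2, X a * X c, X b * X c] :
        Fin 4 → MvPolynomial (Fin n) k) s ∈ Algebra.adjoin k G :=
    fun s => Algebra.subset_adjoin ⟨s, rfl⟩
  have h1 : (X a ^ 3 : MvPolynomial (Fin n) k) ∈ Algebra.adjoin k G := by
    simpa using mem (Sum.inl a)
  have h2 : (X b ^ 3 : MvPolynomial (Fin n) k) ∈ Algebra.adjoin k G := by
    simpa [hab.symm] using mem (Sum.inl b)
  have h3 : (X c ^ 3 : MvPolynomial (Fin n) k) ∈ Algebra.adjoin k G := by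
    simpa [hac.symm, hbc.symm] using mem (Sum.inl c)
  have h4 : (X a ^ 2 * X b : MvPolynomial (Fin n) k) ∈ Algebra.adjoin k G := by
    simpa using mem (Sum.inr 0)
  have h5 : (X a * X b ^ 2 : MvPolynomial (Fin n) k) ∈ Algebra.adjoin k G := by
    simpa using mem (Sum.inr 1)
  have h6 : (X a * X c : MvPolynomial (Fin n) k) ∈ Algebra.adjoin k G := by
    simpa using mem (Sum.inr 2)
  have h7 : (X b * X c : MvPolynomial (Fin n) k) ∈ Algebra.adjoin k G := by
    simpa using mem (Sum.inr 3)
  have hpass : ∀ i, i ≠ a → i ≠ b → i ≠ c → (X i : MvPolynomial (Fin n) k) ∈ Algebra.adjoin k G :=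
    fun i hia hib hic => by simpa [hia, hib, hic] using mem (Sum.inl i)
  exact monomial_mem_of_coneWeight_dvd hab hbc hac h1 h2 h3 h4 h5 h6 h7 hpass d
    ((weight_coneWeight_eq_zero_iff hab hbc hac d).mp hd)

/-- **B0-a** (plan-1 ORDER SIG verbatim): the `⅓(1,1,2)` presentation `Third112.presentation k n a b c`
has range EXACTLY the `ℤ/3`-weight-`0` part of `k[x₁,…,xₙ]` for `coneWeight n a b c` — the
`μ₃`-vertex invariant ring of V4U piece 0. (`⊆`: the images are weight-`0`; `⊇`: semigroup
generation `monomial_mem_range_presentation`; glued by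
`ToricExit.mem_adjoin_iff_isWeightedHomogeneous_zero`, p490929.) [OURS · W4.5c] -/
theorem mem_range_presentation_iff (k : Type) [Field k] (n : ℕ) (a b c : Fin n)
    (hab : a ≠ b) (hbc : b ≠ c) (hac : a ≠ c) (f : MvPolynomial (Fin n) k) :
    f ∈ (presentation k n a b c).range ↔ IsWeightedHomogeneous (coneWeight n a b c) f 0 := by
  rw [range_presentation_eq_adjoin]
  refine ToricExit.mem_adjoin_iff_isWeightedHomogeneous_zero (coneWeight n a b c) _
    (isWeightedHomogeneous_zero_of_mem_range_gens hab hbc hac) (fun d hd => ?_) f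
  have h := monomial_mem_range_presentation k n a b c hab hbc hac d hd
  rwa [range_presentation_eq_adjoin] at h

/-- Corollary: the range of the presentation is closed under taking weight-`0` homogeneous
components — in particular the seven cone monomials and the passengers GENERATE the invariant ring
`k[x]^{μ₃}` (no further generators). Restated as an equality of carrier sets. [OURS · W4.5c] -/
theorem coe_range_presentation_eq (k : Type) [Field k] (n : ℕ) (a b c : Fin n)
    (hab : a ≠ b) (hbc : b ≠ c) (hac : a ≠ c) :
    ((presentation k n a b c).range : Set (MvPolynomial (Fin n) k))
      = {f | IsWeightedHomogeneous (coneWeight n a b c) f 0} := by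
  ext f
  exact mem_range_presentation_iff k n a b c hab hbc hac f

end Range

end Summit.ResolutionOfSingularities.ResolutionOfSingularities.Theorems.WildQuotientResolution.Third112

end
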